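/-
Copyright (c) 2026 the pub-hodgecm-mathlib formalisation cell (harness21).  Prover seat hodgecm-mathlib-K2Liu-p13 (g3), Track B «K2-LIT»,
#184♮ = hLiu418 = `stmt-HodgeConjecture-24832`; ROAD Φ (RULING «M-156n»), consumer sheet fa2b1e3a29709f09 row G6-fin — the GROWTH FACE of the big cell
FROM STANDARDNESS: the `K`-finiteness binders `(V, hVb, hV)` of ★∕📤 `K2LiuBigCellGrowthAssembled.bigCell_growth` DISCHARGED from the socket's own binders
`hstd : IsStandardSectionFamily 𝒦 χ f` + `hcont` (socket #41 ∕ ★ `K2LiuSiegelEisensteinContinuationTop`), leaving the continuation `hEd` as the ONLY binder.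
THEOREMS ONLY (no `def`, no `instance`, no named-fact hypothesis, no `sorry`).
-/
import Summits.HodgeConjecture.HodgeConjecture.Theorems.K2LiuBigCellGrowthAssembled         -- ★∕📤 the ★ binders `hIw`, `hPK`, `hω`, `hωd`; `heqv`
import Summits.HodgeConjecture.HodgeConjecture.Theorems.K2LiuIntertwiningConverges          -- ★ `integrable_weylDelta_mul` (re s > n∕2)
import Literature.NumberTheory.K2Lit.SiegelStandardSections                                -- ★ `IwasawaDatum`, `IsKFinite`, `IsStandardSectionFamily`
import Mathlib.LinearAlgebra.Finsupp.LinearCombination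
import HarnessLib

/-!
# Crux `HLiu418`, ROAD Φ, organ Φ8 (sheet row G6-fin): THE GROWTH FACE OF THE BIG CELL FOR A STANDARD FAMILY — `K`-finiteness of `M(s)f_s` from
# `K`-finiteness and flatness of `f_s` (no Peter–Weyl), so that moderate growth of the continued `a(s)·M(s)f_s` follows from its continuation ALONE

Cell `hodgecm-mathlib`, crux item hLiu418 = `stmt-HodgeConjecture-24832` (helper lane, count-neutral).  GENERIC `n ≠ 0`, doubled frame `H(𝔸) = HA L e dV hdV dW hdW`.
THE POINT.  ★∕📤 `bigCell_growth` took the `K`-finiteness of the continued big cell as a binder `(V, hVb, hV)`.  For a STANDARD family (`f_s ∈ I(s, χ)`, `f_s|_K`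
independent of `s`, `f_{s₀}` `K`-finite, each `f_s` continuous) it is a THEOREM, by pure linear algebra and the section property — no harmonic analysis on `K`:
* §1 `exists_translate_repr` — `K`-finiteness of `φ` gives finitely many `κ_l ∈ K` and bounded coefficient functions `d_l` on `K` with
  `φ(y k) = Σ_l d_l(k) φ(y κ_l)` for ALL `y ∈ H(𝔸)`, `k ∈ K` (★ `exists_pointRepr` on the span of the right translates + unfolding the span);
* §2 `translate_repr_family` — by Iwasawa `y = p κ₀`, the section property at `s` and flatness on `K`, the SAME identity holds for every `f_s`;
* §3 `intertwiningDelta_translate_repr` — integrating over `N_Δ(𝔸)` (★ `integrable_weylDelta_mul`, `re s > n∕2`): `M(s)f_s(k) = Σ_l d_l(k) M(s)f_s(κ_l)`, i.e. the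
  binder `hrep` of ★ `growth_of_equivariance_of_pointRepr` on the convergence half-plane — which that theorem continues to `{0 < re}` by itself;
* §4 **`bigCell_growth_of_standard`** ∕ **`bigCell_growth_of_isStandardSectionFamily`** — moderate growth of `a(s)·M(s)f_s` in `adelicHeightGL (n+n)`, locally
  uniformly on `{0 < re s}`, from `hstd + hcont + (χ unitary) +` the continuation `hEd` ONLY.
Sources: [Garrett2018, §3.10–§3.12]; [MoeglinWaldspurger1995, I.2.17, II.1.6, IV.1]; [HarrisKudlaSweet1996, (1.15)–(1.17), §6]; [KudlaSweet1997, §1];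
[BorelJacquet1979, §1.2]; [Tan1999, §1–§2].
HONEST LABEL.  Helper lemmas, count-neutral; `HC_CM` is proved only modulo the 7 printed citations (2 remaining named inputs:
hLiu418 = `stmt-HodgeConjecture-24832`, h413 = `stmt-HodgeConjecture-24833`) until rung 0 closes.
-/

set_option autoImplicit false
set_option linter.dupNamespace false -- the mandated namespace repeats `HodgeConjecture.HodgeConjecture`

noncomputable section

open scoped Matrix NNReal ENNReal
open NumberField IsDedekindDomain MeasureTheory MeasureTheory.Measure Metric

namespace Summit.HodgeConjecture.HodgeConjecture.Cruxes.HLiu418.K2LiuBigCellGrowthOfStandard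

open Literature.NumberTheory.GelbartRogawski1991.AdaptedBlocks
open Literature.NumberTheory.Automorphic Literature.NumberTheory.Automorphic.UnitaryGroup
open Literature.NumberTheory.GelbartRogawski1991 Literature.NumberTheory.GelbartRogawski1991.GRConstruction
open Literature.NumberTheory.K2Lit.SiegelDoubled Literature.NumberTheory.GaloisRepresentations
open UnitaryDualPair
open Summit.HodgeConjecture.HodgeConjecture.Cruxes.HLiu418.K2LiuIntertwiningDeltaUnconditional
open Summit.HodgeConjecture.HodgeConjecture.Cruxes.HLiu418.K2LiuBigCellGrowthOfEquivariance
open Summit.HodgeConjecture.HodgeConjecture.Cruxes.HLiu418.K2LiuBigCellGrowthAssembled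
open Summit.HodgeConjecture.HodgeConjecture.Cruxes.HLiu418.K2LiuPointEvaluationRepresentation (exists_pointRepr)
open Summit.HodgeConjecture.HodgeConjecture.Cruxes.HLiu418.K2LiuIntertwiningConverges (integrable_weylDelta_mul)

variable (L : Type) [Field L] [NumberField L] [IsCMField L]
variable {N M n : ℕ} (e : Fin N × Fin M ≃ Fin n)
  (dV : Fin N → L) (hdV : ∀ i, IsCMField.complexConj L (dV i) = dV i)
  (dW : Fin M → L) (hdW : ∀ i, IsCMField.complexConj L (dW i) = dW i)

/-! ## §1 `K`-finiteness as a point-translate representation with bounded coefficients -/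

/-- unfolding the span of translates: an element of `rightTranslateSpan 𝒦 φ` is a FINITE combination of right `K`-translates of `φ`. [cite: Tan1999, §1] -/
theorem exists_finsupp_of_mem_rightTranslateSpan (𝒦 : IwasawaDatum L e dV hdV dW hdW) (φ : HA L e dV hdV dW hdW → ℂ)
    {ψ : HA L e dV hdV dW hdW → ℂ} (hψ : ψ ∈ rightTranslateSpan 𝒦 φ) :
    ∃ c : ↥𝒦.K →₀ ℂ, ∀ y : HA L e dV hdV dW hdW, ψ y = ∑ κ ∈ c.support, c κ * φ (y * (κ : HA L e dV hdV dW hdW)) := by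
  obtain ⟨c, hc⟩ := (Finsupp.mem_span_range_iff_exists_finsupp.1 hψ)
  refine ⟨c, fun y => ?_⟩
  rw [← hc]
  simp only [Finsupp.sum, Finset.sum_apply, Pi.smul_apply, smul_eq_mul]

/-- **POINT-TRANSLATE REPRESENTATION OF A `K`-FINITE CONTINUOUS FUNCTION.**  If the right `K`-translates of `φ` span a finite-dimensional space and `φ` is
continuous, there are finitely many `κ_l ∈ K` and coefficient functions `d_l`, uniformly bounded on `K`, with `φ(y k) = Σ_l d_l(k) φ(y κ_l)` for ALL
`y ∈ H(𝔸)` and `k ∈ K`. [cite: BorelJacquet1979, §1.2] [cite: HarrisKudlaSweet1996, (1.16)] [cite: Tan1999, §1] -/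
theorem exists_translate_repr (𝒦 : IwasawaDatum L e dV hdV dW hdW) {φ : HA L e dV hdV dW hdW → ℂ} (hφ : IsKFinite 𝒦 φ) (hφc : Continuous φ) :
    ∃ (T : Finset ↥𝒦.K) (d : ↥𝒦.K → HA L e dV hdV dW hdW → ℂ) (B : ℝ), 0 ≤ B ∧
      (∀ κ, ∀ k ∈ (𝒦.K : Set (HA L e dV hdV dW hdW)), ‖d κ k‖ ≤ B) ∧
      ∀ (y : HA L e dV hdV dW hdW), ∀ k ∈ (𝒦.K : Set (HA L e dV hdV dW hdW)),
        φ (y * k) = ∑ κ ∈ T, d κ k * φ (y * (κ : HA L e dV hdV dW hdW)) := by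
  classical
  haveI : FiniteDimensional ℂ (rightTranslateSpan 𝒦 φ) := hφ
  obtain ⟨x, ψ, hψW, hrep⟩ := exists_pointRepr (rightTranslateSpan 𝒦 φ)
  choose c hc using fun i : ↥x => exists_finsupp_of_mem_rightTranslateSpan L e dV hdV dW hdW 𝒦 φ (hψW i)
  -- bounds: the coefficients `c i κ` and `φ` on the compacts `x_i · K`
  have hφbd : ∀ i : ↥x, ∃ Bi : ℝ, 0 ≤ Bi ∧ ∀ k ∈ (𝒦.K : Set (HA L e dV hdV dW hdW)), ‖φ ((i : HA L e dV hdV dW hdW) * k)‖ ≤ Bi := by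
    intro i
    obtain ⟨Bi, hBi⟩ := (𝒦.isCompact_K.image (continuous_const.mul continuous_id' : Continuous fun k : HA L e dV hdV dW hdW => (i : HA L e dV hdV dW hdW) * k)).exists_bound_of_continuousOn
      hφc.continuousOn
    exact ⟨max Bi 0, le_max_right _ _, fun k hk => (hBi _ (Set.mem_image_of_mem _ hk)).trans (le_max_left _ _)⟩
  choose Bφ hBφ0 hBφ using hφbd
  set Cc : ℝ := ∑ i : ↥x, ∑ κ ∈ (c i).support, ‖c i κ‖ with hCc
  have hCc0 : 0 ≤ Cc := Finset.sum_nonneg fun i _ => Finset.sum_nonneg fun κ _ => norm_nonneg _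
  have hcle : ∀ i κ, ‖c i κ‖ ≤ Cc := by
    intro i κ
    by_cases hκ : κ ∈ (c i).support
    · calc ‖c i κ‖ ≤ ∑ κ' ∈ (c i).support, ‖c i κ'‖ := Finset.single_le_sum (fun κ' _ => norm_nonneg (c i κ')) hκ
        _ ≤ Cc := Finset.single_le_sum (f := fun j => ∑ κ' ∈ (c j).support, ‖c j κ'‖)
            (fun j _ => Finset.sum_nonneg fun κ' _ => norm_nonneg _) (Finset.mem_univ i)
    · rw [Finsupp.notMem_support_iff.1 hκ, norm_zero]; exact hCc0
  refine ⟨Finset.univ.biUnion fun i : ↥x => (c i).support,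
    fun κ k => ∑ i : ↥x, c i κ * φ ((i : HA L e dV hdV dW hdW) * k), ∑ i : ↥x, Cc * Bφ i,
    Finset.sum_nonneg fun i _ => mul_nonneg hCc0 (hBφ0 i), fun κ k hk => ?_, fun y k hk => ?_⟩
  · exact (norm_sum_le _ _).trans (Finset.sum_le_sum fun i _ => by
      rw [norm_mul]; exact mul_le_mul (hcle i κ) (hBφ i k hk) (norm_nonneg _) hCc0)
  · -- `φ(y k) = Σ_i φ(x_i k) ψ_i(y)` and `ψ_i(y) = Σ_{κ ∈ T} c i κ φ(y κ)`
    have h1 := hrep _ (rightTranslate_mem_rightTranslateSpan 𝒦 φ hk) y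
    rw [h1]
    have h2 : ∀ i : ↥x, ψ i y = ∑ κ ∈ Finset.univ.biUnion (fun j : ↥x => (c j).support), c i κ * φ (y * (κ : HA L e dV hdV dW hdW)) := by
      intro i
      rw [hc i y]
      refine Finset.sum_subset (Finset.subset_biUnion_of_mem (fun j : ↥x => (c j).support) (Finset.mem_univ i)) fun κ _ hκ => ?_
      rw [Finsupp.notMem_support_iff.1 hκ, zero_mul]
    simp_rw [h2, Finset.mul_sum, Finset.sum_mul]
    rw [Finset.sum_comm]
    refine Finset.sum_congr rfl fun κ _ => Finset.sum_congr rfl fun i _ => ?_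
    ring

/-! ## §2 The representation propagates along a flat family of sections -/

/-- **PROPAGATION ALONG A FLAT FAMILY.**  If `f_s ∈ I(s, χ)` for every `s`, `f_s|_K` is independent of `s`, and `f_{s₀}(y k) = Σ_l d_l(k) f_{s₀}(y κ_l)` (`κ_l ∈ K`)
for all `y`, `k ∈ K`, then the same identity holds for EVERY `f_s` (Iwasawa `y = p κ₀`, section property, flatness). [cite: HarrisKudlaSweet1996, (1.17)] [cite: Tan1999, §1] -/
theorem translate_repr_family (𝒦 : IwasawaDatum L e dV hdV dW hdW) {χ : HeckeCharacter L} {f : ℂ → HA L e dV hdV dW hdW → ℂ}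
    (hf : ∀ s : ℂ, IsSiegelDeltaSection L e dV hdV dW hdW χ s (f s))
    (hflat : ∀ k ∈ (𝒦.K : Set (HA L e dV hdV dW hdW)), ∀ s s' : ℂ, f s k = f s' k) {s₀ : ℂ}
    {T : Finset ↥𝒦.K} {d : ↥𝒦.K → HA L e dV hdV dW hdW → ℂ}
    (hrep₀ : ∀ (y : HA L e dV hdV dW hdW), ∀ k ∈ (𝒦.K : Set (HA L e dV hdV dW hdW)),
      f s₀ (y * k) = ∑ κ ∈ T, d κ k * f s₀ (y * (κ : HA L e dV hdV dW hdW))) (s : ℂ) (y : HA L e dV hdV dW hdW)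
    {k : HA L e dV hdV dW hdW} (hk : k ∈ (𝒦.K : Set (HA L e dV hdV dW hdW))) :
    f s (y * k) = ∑ κ ∈ T, d κ k * f s (y * (κ : HA L e dV hdV dW hdW)) := by
  obtain ⟨p, κ₀, hp, hκ₀, rfl⟩ := 𝒦.iwasawa y
  have hκ₀k : κ₀ * k ∈ (𝒦.K : Set (HA L e dV hdV dW hdW)) := 𝒦.K.mul_mem hκ₀ hk
  calc f s (p * κ₀ * k) = siegelDeltaCharacter L e dV hdV dW hdW χ s p * f s (κ₀ * k) := by rw [mul_assoc]; exact hf s p hp _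
    _ = siegelDeltaCharacter L e dV hdV dW hdW χ s p * ∑ κ ∈ T, d κ k * f s₀ (κ₀ * (κ : HA L e dV hdV dW hdW)) := by
        rw [hflat _ hκ₀k s s₀, hrep₀ κ₀ k hk]
    _ = ∑ κ ∈ T, d κ k * (siegelDeltaCharacter L e dV hdV dW hdW χ s p * f s (κ₀ * (κ : HA L e dV hdV dW hdW))) := by
        rw [Finset.mul_sum]
        refine Finset.sum_congr rfl fun κ _ => ?_
        rw [hflat _ (𝒦.K.mul_mem hκ₀ κ.2) s₀ s]
        ring
    _ = ∑ κ ∈ T, d κ k * f s (p * κ₀ * (κ : HA L e dV hdV dW hdW)) := by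
        refine Finset.sum_congr rfl fun κ _ => ?_
        rw [mul_assoc p, hf s p hp]

/-! ## §3 Integrating over `N_Δ(𝔸)`: the binder `hrep` for `M(s)f_s` on the convergence half-plane -/

/-- **`hrep` FOR THE BIG CELL on `re s > n∕2`**: `M(s)f_s(k) = Σ_l d_l(k) · M(s)f_s(κ_l)` for `k ∈ K` — integrate §2 at `y = w_Δ u` term by term
(★ `integrable_weylDelta_mul`). [cite: MoeglinWaldspurger1995, II.1.6] [cite: Garrett2018, §3.10] -/
theorem intertwiningDelta_translate_repr (hdV0 : ∀ i, dV i ≠ 0) (hdW0 : ∀ i, dW i ≠ 0) (𝒦 : IwasawaDatum L e dV hdV dW hdW)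
    [MeasurableSpace (unipDelta L e dV hdV dW hdW)] [BorelSpace (unipDelta L e dV hdV dW hdW)]
    (νN : Measure (unipDelta L e dV hdV dW hdW)) [νN.IsHaarMeasure] {χ : HeckeCharacter L} (hχ : χ.IsUnitary)
    {f : ℂ → HA L e dV hdV dW hdW → ℂ} (hf : ∀ s : ℂ, IsSiegelDeltaSection L e dV hdV dW hdW χ s (f s)) (hcont : ∀ s, Continuous (f s))
    {T : Finset ↥𝒦.K} {d : ↥𝒦.K → HA L e dV hdV dW hdW → ℂ}
    (hrepf : ∀ (s : ℂ) (y : HA L e dV hdV dW hdW), ∀ k ∈ (𝒦.K : Set (HA L e dV hdV dW hdW)),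
      f s (y * k) = ∑ κ ∈ T, d κ k * f s (y * (κ : HA L e dV hdV dW hdW)))
    {s : ℂ} (hs : (n : ℝ) / 2 < s.re) {k : HA L e dV hdV dW hdW} (hk : k ∈ (𝒦.K : Set (HA L e dV hdV dW hdW))) :
    intertwiningDelta L e dV hdV dW hdW νN (f s) k =
      ∑ κ ∈ T, intertwiningDelta L e dV hdV dW hdW νN (f s) (κ : HA L e dV hdV dW hdW) * d κ k := by
  unfold intertwiningDelta
  have hint : ∀ κ ∈ T, Integrable (fun u : unipDelta L e dV hdV dW hdW =>
      d κ k * f s (weylDelta L e dV hdV dW hdW * (u : HA L e dV hdV dW hdW) * (κ : HA L e dV hdV dW hdW))) νN := fun κ _ =>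
    (integrable_weylDelta_mul L e dV hdV dW hdW hdV0 hdW0 hχ hs (hf s) (hcont s) νN (κ : HA L e dV hdV dW hdW)).const_mul _
  simp_rw [hrepf s _ k hk]
  rw [integral_finsetSum _ hint]
  refine Finset.sum_congr rfl fun κ _ => ?_
  rw [integral_const_mul, mul_comm]

/-! ## §4 The growth face of the big cell for a standard family: continuation is the only binder -/

/-- **THE GROWTH FACE OF THE BIG CELL FOR A STANDARD FAMILY.**  `f_s ∈ I(s, χ)` (`χ` unitary) with `f_s|_K` independent of `s`, `f_{s₀}` `K`-finite, each `f_s`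
continuous; `νN` Haar on `N_Δ(𝔸)`, `χ′ = (χ ∘ c)⁻¹`, any scalar `a`, `E s := a s · M(s)f_s`.  IF `s ↦ E s x` is holomorphic on `{0 < re}` for every `x` (`hEd`, the
continuation of the big cell) THEN `‖E s x‖ ≤ C · adelicHeightGL(x)^A` locally uniformly on `{0 < re}`.  ★ `growth_of_equivariance_of_pointRepr` with `c = n∕2`:
`hrep`∕`hψ`∕`hB` §1–§3, `heqv` ★ `intertwiningDelta_family_equivariant_of_conj`, `hIw`∕`hPK`∕`hω`∕`hωd` ★ `K2LiuBigCellGrowthAssembled`.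
[cite: Garrett2018, §3.12] [cite: MoeglinWaldspurger1995, I.2.17, IV.1] [cite: HarrisKudlaSweet1996, §6] [cite: KudlaSweet1997, §1] -/
theorem bigCell_growth_of_standard [NeZero n] (hdV0 : ∀ i, dV i ≠ 0) (hdW0 : ∀ i, dW i ≠ 0) (𝒦 : IwasawaDatum L e dV hdV dW hdW)
    [MeasurableSpace (unipDelta L e dV hdV dW hdW)] [BorelSpace (unipDelta L e dV hdV dW hdW)]
    (νN : Measure (unipDelta L e dV hdV dW hdW)) [νN.IsHaarMeasure] (χ χ' : HeckeCharacter L) (hχ : χ.IsUnitary)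
    (hχ' : ∀ u : (AdeleRing (𝓞 L) L)ˣ,
      χ' u = (χ (Units.map (conjAdele (Fp L) L (IsCMField.complexConj L) : AdeleRing (𝓞 L) L →* AdeleRing (𝓞 L) L) u))⁻¹)
    (f : ℂ → HA L e dV hdV dW hdW → ℂ) (hf : ∀ s : ℂ, IsSiegelDeltaSection L e dV hdV dW hdW χ s (f s))
    (hflat : ∀ k ∈ (𝒦.K : Set (HA L e dV hdV dW hdW)), ∀ s s' : ℂ, f s k = f s' k) (s₀ : ℂ) (hKfin : IsKFinite 𝒦 (f s₀))
    (hcont : ∀ s, Continuous (f s)) (a : ℂ → ℂ)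
    (hEd : ∀ x : HA L e dV hdV dW hdW,
      DifferentiableOn ℂ (fun s : ℂ => a s * intertwiningDelta L e dV hdV dW hdW νN (f s) x) {s : ℂ | 0 < s.re}) :
    ∀ z : ℂ, 0 < z.re → ∃ C A ρ : ℝ, 0 ≤ C ∧ 0 ≤ A ∧ 0 < ρ ∧ ∀ s : ℂ, dist s z < ρ → ∀ x : HA L e dV hdV dW hdW,
      ‖a s * intertwiningDelta L e dV hdV dW hdW νN (f s) x‖ ≤ C * adelicHeightGL (n + n) L (x : GL (Fin (n + n)) (AdeleRing (𝓞 L) L)) ^ A := by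
  classical
  obtain ⟨CK, hCK, hPK⟩ := exists_hPK L e dV hdV dW hdW (n := n) 𝒦.isCompact_K
  obtain ⟨T, d, B, hB, hdB, hrep₀⟩ := exists_translate_repr L e dV hdV dW hdW 𝒦 hKfin (hcont s₀)
  have hrepf : ∀ (s : ℂ) (y : HA L e dV hdV dW hdW), ∀ k ∈ (𝒦.K : Set (HA L e dV hdV dW hdW)),
      f s (y * k) = ∑ κ ∈ T, d κ k * f s (y * (κ : HA L e dV hdV dW hdW)) := fun s y k hk =>
    translate_repr_family L e dV hdV dW hdW 𝒦 hf hflat hrep₀ s y hk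
  have hrep : ∀ s : ℂ, (n : ℝ) / 2 < s.re → ∀ k ∈ (𝒦.K : Set (HA L e dV hdV dW hdW)),
      a s * intertwiningDelta L e dV hdV dW hdW νN (f s) k =
        ∑ i : ↥T, a s * intertwiningDelta L e dV hdV dW hdW νN (f s) ((i : ↥𝒦.K) : HA L e dV hdV dW hdW) * d i k := by
    intro s hs k hk
    rw [intertwiningDelta_translate_repr L e dV hdV dW hdW hdV0 hdW0 𝒦 νN hχ hf hcont hrepf hs hk, Finset.mul_sum, ← Finset.sum_coe_sort]
    refine Finset.sum_congr rfl fun i _ => ?_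
    ring
  exact growth_of_equivariance_of_pointRepr (hIw_of_iwasawaDatum L e dV hdV dW hdW 𝒦)
    (fun x : HA L e dV hdV dW hdW => adelicHeightGL (n + n) L (x : GL (Fin (n + n)) (AdeleRing (𝓞 L) L))) (fun _ => adelicHeightGL_nonneg _)
    hCK hPK (fun p _ => hωd_chiDet_modDelta L e dV hdV dW hdW χ' p _) (hω_chiDet_modDelta L e dV hdV dW hdW χ') hEd (by positivity)
    (intertwiningDelta_family_equivariant_of_conj L e dV hdV dW hdW hdV0 hdW0 νN χ χ' hχ' ((n : ℝ) / 2) f hf a)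
    (kpt := fun i : ↥T => ((i : ↥𝒦.K) : HA L e dV hdV dW hdW)) hrep hB (fun i k hk => hdB i k hk)

/-- **THE SAME FROM THE SOCKET'S BINDERS** `hstd : IsStandardSectionFamily 𝒦 χ f`, `hcont : ∀ s, Continuous (f s)` (socket #41 ∕ ★ `siegelEisensteinContinuation_of_rows`):
moderate growth of the continued normalised big cell `a(s)·M(s)f_s` from its continuation `hEd` ALONE, in the `hgrowth` byte shape `∃ C A r, 0 < r ∧ …`.
[cite: Garrett2018, §3.12] [cite: HarrisKudlaSweet1996, §6] [cite: KudlaSweet1997, §1] -/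
theorem bigCell_growth_of_isStandardSectionFamily [NeZero n] (hdV0 : ∀ i, dV i ≠ 0) (hdW0 : ∀ i, dW i ≠ 0) (𝒦 : IwasawaDatum L e dV hdV dW hdW)
    [MeasurableSpace (unipDelta L e dV hdV dW hdW)] [BorelSpace (unipDelta L e dV hdV dW hdW)]
    (νN : Measure (unipDelta L e dV hdV dW hdW)) [νN.IsHaarMeasure] (χ χ' : HeckeCharacter L) (hχ : χ.IsUnitary)
    (hχ' : ∀ u : (AdeleRing (𝓞 L) L)ˣ,
      χ' u = (χ (Units.map (conjAdele (Fp L) L (IsCMField.complexConj L) : AdeleRing (𝓞 L) L →* AdeleRing (𝓞 L) L) u))⁻¹)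
    (f : ℂ → HA L e dV hdV dW hdW → ℂ) (hstd : IsStandardSectionFamily 𝒦 χ f) (hcont : ∀ s, Continuous (f s)) (a : ℂ → ℂ)
    (hEd : ∀ x : HA L e dV hdV dW hdW,
      DifferentiableOn ℂ (fun s : ℂ => a s * intertwiningDelta L e dV hdV dW hdW νN (f s) x) {s : ℂ | 0 < s.re}) :
    ∀ z : ℂ, 0 < z.re → ∃ C A r : ℝ, 0 < r ∧ ∀ s : ℂ, dist s z < r → ∀ x : HA L e dV hdV dW hdW,
      ‖a s * intertwiningDelta L e dV hdV dW hdW νN (f s) x‖ ≤ C * adelicHeightGL (n + n) L (x : GL (Fin (n + n)) (AdeleRing (𝓞 L) L)) ^ A :=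
  fun z hz => by
    obtain ⟨C, A, ρ, -, -, hρ, h⟩ := bigCell_growth_of_standard L e dV hdV dW hdW hdV0 hdW0 𝒦 νN χ χ' hχ hχ' f hstd.1.1
      (fun k hk s s' => hstd.2.2 k hk s s') 0 (hstd.2.1 0) hcont a hEd z hz
    exact ⟨C, A, ρ, hρ, h⟩

end Summit.HodgeConjecture.HodgeConjecture.Cruxes.HLiu418.K2LiuBigCellGrowthOfStandard

end
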